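import Summits.QuantumFields.YangMills.Theorems.IR.AfPincerUcTypChainDeepReduced
import Summits.QuantumFields.YangMills.Theorems.IR.Negative.OnsetSharpFalseOfUnpinnedUnit
import HarnessLib

/-!
# Crux `IR` (stmt-QuantumFields-19354), line `af-pincer-Uc-sharp` — NEGATIVE side of the DEEP re-cut candidate `TypChainDeep`:
# the boundary layers it stops reading are where clause (i)'s frozen data may carry walls; the typed price (film wire)

Negative knowledge for item `stmt-QuantumFields-19354` (`--supports`; closes no stub; verdict of record NOT-REFUTED unchanged; slot «sharp merge
I♯_SC» `Cruxes/IR/Lines/af_pincer_Uc_sharp.lean` sha16 `28967a1bf60ad397` UNTOUCHED).  Author: refuter `ym-19354-disprove-1` GEN 12, answering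
seat `ym-19354-afpincer-s1` g3's closing cc (2026-08-27T18:56:10Z, «typed target if wanted: depth-2 core NOT immune at the sharp mesh») on the
re-cut candidate of `AfPincerUcTypChainDeep{,Reduced}` (p555685 ∕ p557005).

READING.  On the (ii)-side (`KernelPlaqSparseDeep`) this seat found no kill mechanism: deterministic forcing of deep atypicality is zero
(`one_mem_typChainDeep`), the zero-temperature flux of a centre-twisted boundary loop spreads over `≥ b²` plaquettes (`≲ π²/(2b⁴)` each), the
condition is per-set (`q^#X`, no entropy), and both probes agree (S1 kit j287360: depth `≥ 2` carries `≤ 0.001`; LEAD: `≤ 0.03` of the exterior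
level).  The cost of the re-cut sits on clause (i) (`ClauseIAll`: centre-cell mixing for pairs of data TYPICAL off `Y` on window+shell, equal
on the window cells off `Y`): for `D ≥ 1` typicality is read on the depth-`D` core only, so data equal to the identity on every core and
ARBITRARY in the boundary layers — e.g. designed walls on the faces along `Y` — are typical for EVERY `θ > 0`, `ℓ₀`, `D' ≥ D` (§1), whereas
`TypChain = TypChainDeep … 0` excludes every wall whose in-face plaquettes are `θ`-bad along a segment of length `≥ ℓ₀` (§2, explicitly).  The
re-cut thus re-admits on the (i)-side the frozen walls that the wall-reading of `TypChain` excluded — this lineage's GEN 2 film scenario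
(designed `SU(2)` faces with two-state surface order: remanent polarisation `τ_∞ ≈ 0.015 … 0.092`, flat in the face size `M = 6 → 12`, laterally
stable, surface-localised action `45 ∕ 5.7 ∕ 0.15 ∕ 0.008` by layer, `p = 2` degeneracy symmetry-exact to `1e-14`; `filmcensus-tables.txt`, kit
j263436 ∕ j263438 ∕ j263442 ∕ j265791 ∕ j265792 ∕ j265940 ∕ j266264 on the item).  Depth reading: at `D = 0` core-clean data leave free only each
frozen cell's outgoing normal links (pure staple fields `g(y)⁻¹ g(y + eⱼ)`, gauge-removable in the kernel away from the centre cell), so no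
wall; from `D = 1` on the in-face links of the outermost site layers are free too (`not_mem_plaquetteEdges_of_collar`): staple fields of
ARBITRARY in-face plaquette content sit against the resampled region — that is the exposure.

PROVED (no `sorry`; axioms ⊆ {propext, Classical.choice, Quot.sound}):
* §1 `CoreClean w D c σ` (identity on the deep plaquettes' edges) ⇒ `σ ∈ TypChainDeep ρ θ w ℓ₀ D' c` for all `θ > 0`, `ℓ₀`, `D' ≥ D`
  (`mem_typChainDeep_of_coreClean`); the class reads `deepEdges w D c` only (`typChainDeep_dependsOn_deepEdges`); no edge based within `D` of a
  frame hyperplane is an edge of a depth-`D` deep plaquette of ANY cell (`not_mem_plaquetteEdges_of_collar`, `coreClean_of_eq_one_off_collars`).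
* §2 in every mesh-`b` frame (`b ≥ 2`, `b ≥ ℓ₀ + 1`), for every cell `c` and `θ ≤ N − Re tr ρ g`: the wall line of the cell's bottom layer is
  core-clean at every depth `≥ 1` for EVERY cell yet NOT in `TypChain ρ θ w ℓ₀ c` (`exists_deepTypical_not_mem_typChain`).
* §3 the FILM WIRE `DeepFilmWireAt ρ D n η` (GEN 2's scenario typed UNIFORMLY IN THE MESH, verbatim against `FixedMesh.ClauseI` with core-clean
  data) ⇒ ∀ `θ > 0`, `ℓ₀`, `D' ≥ D`, `ε ≤ η`, at every mesh some frame violates `ClauseI` ∕ `ClauseIAll` for `TypChainDeep ρ θ w ℓ₀ D'`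
  (`exists_frame_not_clauseIAll_of_wireAt`); monotone in `D`, antitone in `η`.
* §4 every witness of `TypChainDeepSharpSC` prints `(n, ε, θ, ℓ₀, D)` with `0 < θ → ∀ η ≥ 1/16, ¬ DeepFilmWireAt r.ρ D n η`, every witness of
  `TypChainDeepReducedAtSC` prints `(n, ε, θ, κ, C, D)` with `∀ η ≥ 1/16, ¬ DeepFilmWireAt r.ρ D n η` (`ε ≤ 1/16` is forced by `ε · shellCount n ≤ 3/4`).

NOT PROVED: the wire (surface order of designed three-dimensional face films in four-dimensional `SU(2)` at large `β`, uniformly in the mesh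
— a thermal Peierls step, supported only by the GEN 2 zero-temperature census and its Ising reading `β_order ≈ 5 – 30`); whether
`TypChain`-typical boundary data (sub-threshold or dust walls) also carry film order is open (GEN 2: smooth ∕ constant faces never bistable,
`14/14`; `U(1)`-flux faces `τ ≤ 0`).  Nothing here refutes `TypChainDeepSharpSC`, `OnsetSharpUKPcSC` or `IR`.  Not a mass gap; not Clay.
-/

set_option autoImplicit false

noncomputable section

open MeasureTheory Filter Topology
open Literature.MathematicalPhysics.QuantumFieldTheory hiding ZdEdge
open Literature.MathematicalPhysics.QuantumLattice
open Literature.Probability.LatticeModels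
open Summit.QuantumFields.YangMills.Cruxes.IR.Tempered (cellEdges windowCells regionEdges)
open Summit.QuantumFields.YangMills.Cruxes.IR.ShellTempered (windowCellsPlus)
open Summit.QuantumFields.YangMills.Cruxes.IR.FixedMesh (ClauseI)
open Summit.QuantumFields.YangMills.Theorems.OddTorusChessboard (cellPlaqs cellSites mem_cellSites plaqAction plaqAction_congr
  plaqAction_one grid_monotone)

namespace Summit.QuantumFields.YangMills.Cruxes.IR.AfPincerUc.SharpLanes.DeepFilm

open Summit.QuantumFields.YangMills.Cruxes.IR.AfPincerUc
open Summit.QuantumFields.YangMills.Cruxes.IR.AfPincerUc.SharpLanes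

/-! ## §1 Core-clean data are deep-typical; the deep class does not read the boundary layers -/
section Core

variable {G : Type} [Group G] {N : ℕ} (ρ : G →* Matrix (Fin N) (Fin N) ℂ)

/-- **Core-clean data of the cell `c` at depth `D`**: the configuration is the identity on every edge of every deep plaquette
(`deepPlaqs w D c`); its boundary layers of depth `< D` are unconstrained. -/
def CoreClean (w : Fin 4 → ℤ → ℤ) (D : ℕ) (c : Fin 4 → ℤ) (σ : LGConfig 4 G) : Prop :=
  ∀ p ∈ deepPlaqs w D c, ∀ e ∈ plaquetteEdges p, σ e = 1

variable {ρ}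

/-- Core-cleanness is monotone in the depth: a configuration clean at depth `D` is clean at every `D' ≥ D`. -/
theorem CoreClean.anti {w : Fin 4 → ℤ → ℤ} {D D' : ℕ} (hDD' : D ≤ D') {c : Fin 4 → ℤ} {σ : LGConfig 4 G}
    (h : CoreClean w D c σ) : CoreClean w D' c σ :=
  fun p hp e he => h p (deepPlaqs_anti w hDD' c hp) e he

variable (ρ)

/-- A deep plaquette of a core-clean configuration has zero action. -/
theorem plaqAction_eq_zero_of_coreClean {w : Fin 4 → ℤ → ℤ} {D : ℕ} {c : Fin 4 → ℤ} {σ : LGConfig 4 G}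
    (h : CoreClean w D c σ) {p : ZdPlaquette 4} (hp : p ∈ deepPlaqs w D c) : plaqAction ρ p σ = 0 := by
  have h1 : plaqAction ρ p σ = plaqAction ρ p (1 : LGConfig 4 G) :=
    plaqAction_congr ρ p fun e he => by rw [h p hp e he]; rfl
  rw [h1, plaqAction_one]

/-- Data all of whose deep plaquettes are `θ`-good lie in the deep class (every chain starts at a bad deep plaquette). -/
theorem mem_typChainDeep_of_forall_lt {θ : ℝ} {w : Fin 4 → ℤ → ℤ} {ℓ₀ D : ℕ} {c : Fin 4 → ℤ} {σ : LGConfig 4 G}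
    (h : ∀ p ∈ deepPlaqs w D c, plaqAction ρ p σ < θ) : σ ∈ TypChainDeep ρ θ w ℓ₀ D c := by
  rintro ⟨k, ch, hin, hbad, -, -⟩
  exact absurd (hbad 0) (not_le.2 (h _ (Finset.mem_coe.1 (hin 0))))

/-- **Core-clean data are deep-typical (PROVED)**: for every `θ > 0`, every `ℓ₀` and every depth `D' ≥ D`. -/
theorem mem_typChainDeep_of_coreClean {θ : ℝ} (hθ : 0 < θ) {w : Fin 4 → ℤ → ℤ} {D D' : ℕ} (hDD' : D ≤ D') (ℓ₀ : ℕ)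
    {c : Fin 4 → ℤ} {σ : LGConfig 4 G} (h : CoreClean w D c σ) : σ ∈ TypChainDeep ρ θ w ℓ₀ D' c :=
  mem_typChainDeep_of_forall_lt ρ fun p hp => by
    rw [plaqAction_eq_zero_of_coreClean ρ (h.anti hDD') hp]; exact hθ

/-- The edges read by the deep class: the edges of the deep plaquettes. -/
def deepEdges (w : Fin 4 → ℤ → ℤ) (D : ℕ) (c : Fin 4 → ℤ) : Finset (ZdEdge 4) :=
  (deepPlaqs w D c).biUnion plaquetteEdges

/-- **The deep class reads the deep edges only (PROVED)**: membership in `TypChainDeep ρ θ w ℓ₀ D c` depends on the restriction to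
`deepEdges w D c`; the boundary layers of depth `< D` are not read at all. -/
theorem typChainDeep_dependsOn_deepEdges (θ : ℝ) (w : Fin 4 → ℤ → ℤ) (ℓ₀ D : ℕ) (c : Fin 4 → ℤ) :
    DependsOn (fun σ : LGConfig 4 G => σ ∈ TypChainDeep ρ θ w ℓ₀ D c) ↑(deepEdges w D c) := by
  intro U V hUV
  have hq : ∀ q ∈ (↑(deepPlaqs w D c) : Set (ZdPlaquette 4)), plaqAction ρ q U = plaqAction ρ q V := by
    intro q hq
    exact plaqAction_congr ρ q fun e he =>
      hUV e (Finset.mem_coe.2 (Finset.mem_biUnion.2 ⟨q, Finset.mem_coe.1 hq, he⟩))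
  simp only [TypChainDeep, Set.mem_setOf_eq]
  exact propext ⟨fun hU hV => hU (hV.congr fun q hq' => (hq q hq').symm), fun hV hU => hV (hU.congr hq)⟩

/-- The base point of an edge of a deep plaquette is a core site. -/
theorem fst_mem_deepSites_of_mem_plaquetteEdges {w : Fin 4 → ℤ → ℤ} {D : ℕ} {c : Fin 4 → ℤ} {p : ZdPlaquette 4}
    (hp : p ∈ deepPlaqs w D c) {e : ZdEdge 4} (he : e ∈ plaquetteEdges p) : e.1 ∈ deepSites w D c := by
  obtain ⟨-, h0, hi, hj⟩ := mem_deepPlaqs.1 hp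
  simp only [plaquetteEdges, Finset.mem_insert, Finset.mem_singleton] at he
  rcases he with rfl | rfl | rfl | rfl
  · exact h0
  · exact hi
  · exact hj
  · exact h0

/-- **Frame collars are invisible to the deep class (PROVED).**  For a frame with monotone grid lines, an edge whose base point lies
within `D` of a frame hyperplane `{x | x i = w i k}` (on either side: `w i k − D ≤ x i < w i k + D`) is not an edge of any depth-`D` deep
plaquette of ANY cell: the links of the cells' outermost `D` layers on both sides of every face — where frozen walls adjacent to a resampled
region live — are unread. -/
theorem not_mem_plaquetteEdges_of_collar {w : Fin 4 → ℤ → ℤ} (hw : ∀ i, Monotone (w i)) {i : Fin 4} {k : ℤ} {D : ℕ}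
    {e : ZdEdge 4} (he : w i k - (D : ℤ) ≤ e.1 i ∧ e.1 i < w i k + (D : ℤ)) (c : Fin 4 → ℤ) {p : ZdPlaquette 4}
    (hp : p ∈ deepPlaqs w D c) : e ∉ plaquetteEdges p := by
  intro hep
  obtain ⟨h1, h2⟩ := (mem_deepSites.1 (fst_mem_deepSites_of_mem_plaquetteEdges hp hep)) i
  obtain ⟨he1, he2⟩ := he
  by_cases hck : k ≤ c i
  · have := hw i hck
    omega
  · have : w i (c i + 1) ≤ w i k := hw i (by omega)
    omega

/-- Hence: a configuration equal to the identity off the links based in the depth-`D` collars of the frame hyperplanes is core-clean at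
depth `D` for every cell — whatever it does inside the collars. -/
theorem coreClean_of_eq_one_off_collars {w : Fin 4 → ℤ → ℤ} (hw : ∀ i, Monotone (w i)) {D : ℕ} {σ : LGConfig 4 G}
    (hσ : ∀ e : ZdEdge 4, (∀ i k, ¬ (w i k - (D : ℤ) ≤ e.1 i ∧ e.1 i < w i k + (D : ℤ))) → σ e = 1) (c : Fin 4 → ℤ) :
    CoreClean w D c σ := by
  intro p hp e he
  by_contra hne
  refine absurd he ?_
  have : ¬ ∀ i k, ¬ (w i k - (D : ℤ) ≤ e.1 i ∧ e.1 i < w i k + (D : ℤ)) := fun hall => hne (hσ e hall)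
  push Not at this
  obtain ⟨i, k, hik⟩ := this
  exact not_mem_plaquetteEdges_of_collar hw hik c hp

end Core

/-! ## §2 What the re-cut re-admits: a depth-`1`-clean configuration outside `TypChain` -/
section Wall

variable {G : Type} [Group G] {N : ℕ} (ρ : G →* Matrix (Fin N) (Fin N) ℂ)

/-- `supNormZ4` of a coordinate vector. -/
theorem supNormZ4_single (i : Fin 4) (z : ℤ) : supNormZ4 (Pi.single i z) = z.natAbs := by
  refine le_antisymm (supNormZ4_le_iff.2 fun j => ?_) (by simpa using natAbs_apply_le_supNormZ4 (Pi.single i z) i)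
  by_cases h : j = i
  · subst h; simp
  · simp [Pi.single_eq_of_ne h]

/-- **The wall line**: `g` on the `0`-links based at the sites `x` with `(x 0, x 1) = (a, m)`, the identity elsewhere.  Its `θ`-bad
plaquettes in the site layer `{x 1 = m}` are the `(0,1)`-plaquettes based at `(a, m, ·, ·)` (holonomy `g`): a two-parameter sheet inside ONE
site layer — a (crude) designed wall. -/
def lineConfig (g : G) (a m : ℤ) : LGConfig 4 G :=
  fun e => if e.2 = 0 ∧ e.1 0 = a ∧ e.1 1 = m then g else 1

/-- With `m = w 1 k` a frame point the wall line lives on a frame hyperplane: it is core-clean at every depth `≥ 1` for EVERY cell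
(`coreClean_of_eq_one_off_collars`). -/
theorem coreClean_lineConfig {w : Fin 4 → ℤ → ℤ} (hw : ∀ i, Monotone (w i)) (g : G) (a k : ℤ) {D : ℕ} (hD : 1 ≤ D)
    (c : Fin 4 → ℤ) : CoreClean w D c (lineConfig g a (w 1 k)) :=
  have hD' : (1 : ℤ) ≤ D := by exact_mod_cast hD
  coreClean_of_eq_one_off_collars hw (fun _ he => if_neg fun h => he 1 k ⟨by omega, by omega⟩) c

/-- The action of a `(0,1)`-plaquette based on the line is `N − Re tr ρ g` (holonomy `g · 1 · 1⁻¹ · 1⁻¹`). -/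
theorem plaqAction_lineConfig (g : G) {a m : ℤ} (x : Site 4) (ha : x 0 = a) (hm : x 1 = m) :
    plaqAction ρ (x, ⟨((0 : Fin 4), (1 : Fin 4)), by decide⟩) (lineConfig g a m) = (N : ℝ) - (ρ g).trace.re := by
  simp [plaqAction, plaquetteObs, plaquetteHolonomyZd, lineConfig, ha, hm]

/-- The straight chain of own `(0,1)`-plaquettes of the cell `c` along direction `2`, starting at the cell's corner. -/
def wallChain (w : Fin 4 → ℤ → ℤ) (c : Fin 4 → ℤ) (ℓ₀ : ℕ) (t : Fin (ℓ₀ + 1)) : ZdPlaquette 4 :=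
  ((fun i => w i (c i)) + Pi.single 2 ((t : ℕ) : ℤ), ⟨((0 : Fin 4), (1 : Fin 4)), by decide⟩)

/-- In a mesh-`b` frame with `b ≥ 2`, `b ≥ ℓ₀ + 1` the chain consists of own plaquettes of the cell. -/
theorem wallChain_mem_cellPlaqs {b : ℕ} {w : Fin 4 → ℤ → ℤ} (hw : IsFrame b w) (hb : 2 ≤ b) {ℓ₀ : ℕ} (hℓ : ℓ₀ + 1 ≤ b)
    (c : Fin 4 → ℤ) (t : Fin (ℓ₀ + 1)) : wallChain w c ℓ₀ t ∈ cellPlaqs w c := by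
  have hside : ∀ i, w i (c i) + (b : ℤ) ≤ w i (c i + 1) := fun i => (hw i (c i)).1
  have ht : (t : ℕ) ≤ ℓ₀ := Nat.lt_succ_iff.1 t.isLt
  have hmem : ∀ v : Site 4, (∀ i, 0 ≤ v i ∧ v i < (b : ℤ)) → (fun i => w i (c i)) + v ∈ cellSites w c := fun v hv =>
    mem_cellSites.2 fun i => by have := hside i; have := hv i; simp only [Pi.add_apply]; omega
  refine Finset.mem_filter.2 ⟨Finset.mem_product.2 ⟨hmem _ fun i => ?_, Finset.mem_univ _⟩, ?_, ?_⟩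
  · fin_cases i <;> simp <;> omega
  · show (fun i => w i (c i)) + Pi.single 2 ((t : ℕ) : ℤ) + Pi.single (0 : Fin 4) (1 : ℤ) ∈ cellSites w c
    rw [add_assoc]
    exact hmem _ fun i => by fin_cases i <;> simp <;> omega
  · show (fun i => w i (c i)) + Pi.single 2 ((t : ℕ) : ℤ) + Pi.single (1 : Fin 4) (1 : ℤ) ∈ cellSites w c
    rw [add_assoc]
    exact hmem _ fun i => by fin_cases i <;> simp <;> omega

/-- The chain's plaquettes are `(0,1)`-plaquettes at their base points (definitional). -/
theorem wallChain_eq (w : Fin 4 → ℤ → ℤ) (c : Fin 4 → ℤ) (ℓ₀ : ℕ) (t : Fin (ℓ₀ + 1)) :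
    wallChain w c ℓ₀ t = ((wallChain w c ℓ₀ t).1, ⟨((0 : Fin 4), (1 : Fin 4)), by decide⟩) := rfl

/-- Every plaquette of the chain is `g`-valued under the wall line of the cell's bottom `1`-layer. -/
theorem plaqAction_wallChain (g : G) (w : Fin 4 → ℤ → ℤ) (c : Fin 4 → ℤ) (ℓ₀ : ℕ) (t : Fin (ℓ₀ + 1)) :
    plaqAction ρ (wallChain w c ℓ₀ t) (lineConfig g (w 0 (c 0)) (w 1 (c 1))) = (N : ℝ) - (ρ g).trace.re := by
  have h0 : (wallChain w c ℓ₀ t).1 0 = w 0 (c 0) := by simp [wallChain]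
  have h1 : (wallChain w c ℓ₀ t).1 1 = w 1 (c 1) := by simp [wallChain]
  rw [wallChain_eq]
  exact plaqAction_lineConfig ρ g _ h0 h1

/-- **The wall line is NOT short-chain typical (PROVED)**: in a mesh-`b` frame with `b ≥ 2`, `b ≥ ℓ₀ + 1`, for every `θ ≤ N − Re tr ρ g`
(every threshold up to the plaquette action of `g`), the wall line of the cell's bottom `1`-layer carries the `θ`-bad chain `wallChain` of
extent `ℓ₀` among the cell's own plaquettes, so it lies outside `TypChain ρ θ w ℓ₀ c = TypChainDeep ρ θ w ℓ₀ 0 c`. -/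
theorem lineConfig_not_mem_typChain {b : ℕ} {w : Fin 4 → ℤ → ℤ} (hw : IsFrame b w) (hb : 2 ≤ b) {ℓ₀ : ℕ} (hℓ : ℓ₀ + 1 ≤ b)
    (c : Fin 4 → ℤ) {θ : ℝ} {g : G} (hg : θ ≤ (N : ℝ) - (ρ g).trace.re) :
    lineConfig g (w 0 (c 0)) (w 1 (c 1)) ∉ TypChain ρ θ w ℓ₀ c := by
  intro hT
  refine hT ⟨ℓ₀, wallChain w c ℓ₀, fun t => Finset.mem_coe.2 (wallChain_mem_cellPlaqs hw hb hℓ c t), fun t => ?_,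
    fun t => ?_, ?_⟩
  · rw [plaqAction_wallChain]; exact hg
  · have hdiff : (wallChain w c ℓ₀ t.castSucc).1 - (wallChain w c ℓ₀ t.succ).1 = Pi.single 2 (-1 : ℤ) := by
      ext i
      simp only [wallChain, Pi.sub_apply, Pi.add_apply, Pi.single_apply, Fin.val_castSucc, Fin.val_succ]
      split_ifs <;> push_cast <;> ring
    rw [hdiff, supNormZ4_single]; decide
  · have hdiff : (wallChain w c ℓ₀ 0).1 - (wallChain w c ℓ₀ (Fin.last ℓ₀)).1 = Pi.single 2 (-(ℓ₀ : ℤ)) := by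
      ext i
      simp only [wallChain, Pi.sub_apply, Pi.add_apply, Pi.single_apply, Fin.val_zero, Fin.val_last]
      split_ifs <;> push_cast <;> ring
    rw [hdiff, supNormZ4_single]; simp

/-- **`TypChain ⊊ TypChainDeep … D` exactly by boundary-layer walls, explicitly (PROVED).**  In every mesh-`b` frame with `b ≥ 2`,
`b ≥ ℓ₀ + 1`, for every cell `c` and every `θ ≤ N − Re tr ρ g`: a configuration core-clean at EVERY depth `D ≥ 1` for EVERY cell — hence in
`TypChainDeep ρ θ' w ℓ₀' D c'` for all `θ' > 0`, `ℓ₀'`, `D ≥ 1`, `c'` — that is NOT in `TypChain ρ θ w ℓ₀ c`.  The deep re-cut re-admits as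
typical frozen data precisely such boundary-layer walls, which the wall-reading of the class of record excludes. -/
theorem exists_deepTypical_not_mem_typChain {b : ℕ} {w : Fin 4 → ℤ → ℤ} (hw : IsFrame b w) (hb : 2 ≤ b) {ℓ₀ : ℕ}
    (hℓ : ℓ₀ + 1 ≤ b) (c : Fin 4 → ℤ) {θ : ℝ} {g : G} (hg : θ ≤ (N : ℝ) - (ρ g).trace.re) :
    ∃ σ : LGConfig 4 G, (∀ D : ℕ, 1 ≤ D → ∀ c' : Fin 4 → ℤ, CoreClean w D c' σ) ∧
      (∀ θ' : ℝ, 0 < θ' → ∀ ℓ₀' D : ℕ, 1 ≤ D → ∀ c' : Fin 4 → ℤ, σ ∈ TypChainDeep ρ θ' w ℓ₀' D c') ∧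
      σ ∉ TypChain ρ θ w ℓ₀ c :=
  ⟨lineConfig g (w 0 (c 0)) (w 1 (c 1)), fun _ hD c' => coreClean_lineConfig (grid_monotone hw) g _ _ hD c',
    fun _ hθ' ℓ₀' _ hD c' => mem_typChainDeep_of_coreClean ρ hθ' le_rfl ℓ₀' (coreClean_lineConfig (grid_monotone hw) g _ _ hD c'),
    lineConfig_not_mem_typChain ρ hw hb hℓ c hg⟩

end Wall

/-! ## §3 The film wire (uniform in the mesh) and what it costs clause (i) of every deep supplier -/
section Wire

variable {G : Type} [Group G] [TopologicalSpace G] [IsTopologicalGroup G] [CompactSpace G]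
  [MeasurableSpace G] [BorelSpace G]

/-- **The film wire at depth `D`, window parameter `n`, contrast `η`** for the Wilson kernels of `ρ` — this lineage's GEN 2 film scenario typed
UNIFORMLY IN THE MESH and verbatim against `FixedMesh.ClauseI`: from some coupling `β₀` on, at EVERY mesh `b ≥ 1` some mesh-`b` frame `w`
carries an admissible resampled family `Y ∋ 0` inside the radius-`n` window and a pair of data `σ, σ'` — both CORE-CLEAN at depth `D` on every
cell of window+shell off `Y` (hence typical for every deep class of depth `≥ D`, §1; their boundary layers, e.g. film-inducing walls on the
faces along `Y` and phase-selecting caps in the shell, are free) and EQUAL on the window cells off `Y` — whose `Y`-kernels differ by MORE than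
`η` on some `[0,1]`-valued measurable cylinder observable of the centre cell.  NOT proved here (surface order of designed face films, a
thermal Peierls step); its fixed-data, fixed-mesh, zero-temperature shadow is the GEN 2 census quoted in the module docstring. -/
def DeepFilmWireAt {N : ℕ} (ρ : G →* Matrix (Fin N) (Fin N) ℂ) (D n : ℕ) (η : ℝ) : Prop :=
  ∃ β₀ : ℝ, ∀ β : ℝ, β₀ ≤ β → ∀ b : ℕ, 1 ≤ b → ∃ w : Fin 4 → ℤ → ℤ, IsFrame b w ∧
    ∃ Y : Finset (Fin 4 → ℤ), Y ⊆ windowCells n ∧ (0 : Fin 4 → ℤ) ∈ Y ∧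
      ∃ σ σ' : LGConfig 4 G,
        (∀ c ∈ windowCellsPlus n, c ∉ Y → CoreClean w D c σ ∧ CoreClean w D c σ') ∧
        (∀ c ∈ windowCellsPlus n, c ∉ Y → c ∈ windowCells n → ∀ e ∈ cellEdges w c, σ e = σ' e) ∧
        ∃ f : LGConfig 4 G → ℝ, IsCylinder f (cellEdges w 0) ∧ Measurable f ∧ (∀ U, 0 ≤ f U ∧ f U ≤ 1) ∧
          η < |(∫ U, f U ∂(ymSpecification ρ β (regionEdges w Y) σ)) -
                ∫ U, f U ∂(ymSpecification ρ β (regionEdges w Y) σ')|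

variable {N : ℕ} (ρ : G →* Matrix (Fin N) (Fin N) ℂ)

/-- The wire is monotone in the depth (core-clean at `D` is core-clean at `D' ≥ D`) and antitone in the contrast. -/
theorem DeepFilmWireAt.mono {D D' n : ℕ} {η η' : ℝ} (hDD' : D ≤ D') (hη : η' ≤ η) (h : DeepFilmWireAt ρ D n η) :
    DeepFilmWireAt ρ D' n η' := by
  obtain ⟨β₀, h⟩ := h
  refine ⟨β₀, fun β hβ b hb => ?_⟩
  obtain ⟨w, hw, Y, hY, h0, σ, σ', hclean, hagree, f, hf, hfm, hf01, hgap⟩ := h β hβ b hb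
  exact ⟨w, hw, Y, hY, h0, σ, σ', fun c hc hcY => ⟨(hclean c hc hcY).1.anti hDD', (hclean c hc hcY).2.anti hDD'⟩, hagree,
    f, hf, hfm, hf01, hη.trans_lt hgap⟩

/-- **One instance of the wire's data refutes clause (i) for every deep class of depth `≥ D`, every `θ > 0`, every `ℓ₀`, every `ε ≤ η`
(PROVED)** — the data are typical by `mem_typChainDeep_of_coreClean`, and `ClauseI` bounds the very difference the instance makes `> η`. -/
theorem not_clauseI_typChainDeep_of_instance {β θ ε η : ℝ} (hθ : 0 < θ) (hε : ε ≤ η) {w : Fin 4 → ℤ → ℤ} {n D D' ℓ₀ : ℕ}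
    (hDD' : D ≤ D') {Y : Finset (Fin 4 → ℤ)} (hY : Y ⊆ windowCells n) (h0 : (0 : Fin 4 → ℤ) ∈ Y) {σ σ' : LGConfig 4 G}
    (hclean : ∀ c ∈ windowCellsPlus n, c ∉ Y → CoreClean w D c σ ∧ CoreClean w D c σ')
    (hagree : ∀ c ∈ windowCellsPlus n, c ∉ Y → c ∈ windowCells n → ∀ e ∈ cellEdges w c, σ e = σ' e)
    {f : LGConfig 4 G → ℝ} (hf : IsCylinder f (cellEdges w 0)) (hfm : Measurable f) (hf01 : ∀ U, 0 ≤ f U ∧ f U ≤ 1)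
    (hgap : η < |(∫ U, f U ∂(ymSpecification ρ β (regionEdges w Y) σ)) - ∫ U, f U ∂(ymSpecification ρ β (regionEdges w Y) σ')|) :
    ¬ ClauseI ρ β w n ε (TypChainDeep ρ θ w ℓ₀ D') := by
  intro hI
  have hle := hI Y hY h0 σ σ' (fun c hc hcY =>
    ⟨mem_typChainDeep_of_coreClean ρ hθ hDD' ℓ₀ (hclean c hc hcY).1,
      mem_typChainDeep_of_coreClean ρ hθ hDD' ℓ₀ (hclean c hc hcY).2⟩) hagree f hf hfm hf01
  exact (lt_irrefl η) ((hgap.trans_le hle).trans_le hε)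

/-- `ClauseIAll` contains `ClauseI` (the centre `c₀ = 0`, `shiftFrame_zero`). -/
theorem clauseI_of_clauseIAll {β : ℝ} {w : Fin 4 → ℤ → ℤ} {n : ℕ} {ε : ℝ} {Typ : (Fin 4 → ℤ) → Set (LGConfig 4 G)}
    (h : ClauseIAll ρ β w n ε Typ) : ClauseI ρ β w n ε Typ := by
  have h0 := h 0
  have hT : (fun c : Fin 4 → ℤ => Typ (c + 0)) = Typ := by funext c; rw [add_zero]
  rw [OnsetFormatsUc.shiftFrame_zero, hT] at h0
  exact h0

/-- **The wire kills the (i)-demand of every deep class of depth `≥ D` at EVERY mesh (PROVED):** under `DeepFilmWireAt ρ D n η`, for all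
large `β`, every mesh `b ≥ 1`, every `θ > 0`, `ℓ₀`, `D' ≥ D` and every `ε ≤ η`, some mesh-`b` frame violates `ClauseI` — hence `ClauseIAll` —
for `TypChainDeep ρ θ w ℓ₀ D'`. -/
theorem exists_frame_not_clauseIAll_of_wireAt {D n : ℕ} {η : ℝ} (hW : DeepFilmWireAt ρ D n η) :
    ∃ β₀ : ℝ, ∀ β : ℝ, β₀ ≤ β → ∀ b : ℕ, 1 ≤ b → ∀ θ : ℝ, 0 < θ → ∀ ε : ℝ, ε ≤ η → ∀ ℓ₀ D' : ℕ, D ≤ D' →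
      ∃ w : Fin 4 → ℤ → ℤ, IsFrame b w ∧ ¬ ClauseI ρ β w n ε (TypChainDeep ρ θ w ℓ₀ D') ∧
        ¬ ClauseIAll ρ β w n ε (TypChainDeep ρ θ w ℓ₀ D') := by
  obtain ⟨β₀, h⟩ := hW
  refine ⟨β₀, fun β hβ b hb θ hθ ε hε ℓ₀ D' hDD' => ?_⟩
  obtain ⟨w, hw, Y, hY, h0, σ, σ', hclean, hagree, f, hf, hfm, hf01, hgap⟩ := h β hβ b hb
  have hnot := not_clauseI_typChainDeep_of_instance ρ hθ hε (ℓ₀ := ℓ₀) hDD' hY h0 hclean hagree hf hfm hf01 hgap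
  exact ⟨w, hw, hnot, fun hAll => hnot (clauseI_of_clauseIAll ρ hAll)⟩

end Wire

/-! ## §4 Supplier-level consequences: every deep supplier prints `(n, D)` OUTSIDE the film wire -/
section Supplier

open Summit.QuantumFields.YangMills.Cruxes.OSLegsFromFemtoAndGap.DlrCollarTransfer (LowerBounds)

/-- **Every witness of `TypChainDeepSharpSC` avoids the film wire (PROVED).**  At any SC datum `(G, r, a)` with `LowerBounds`, a supplier of
`TypChainDeepSharpSC` prints `(n, ε, θ, ℓ₀, D)` such that, if `θ > 0`, `¬ DeepFilmWireAt r.ρ D n η` for every contrast `η ≥ 1/16` (its `ε` is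
`≤ 1/16`): a supplier proving clause (i) for a deep class `D ≥ 1` thereby refutes film order for core-clean designed walls at its own window
parameter.  Calibration of the supplier's `(D, n)`, not a refutation of the format. -/
theorem typChainDeepSharpSC_avoids_filmWire (h : TypChainDeepSharpSC) (G : Type) [Group G] [TopologicalSpace G]
    [IsTopologicalGroup G] [CompactSpace G] (hG : IsCompactSimpleLieGroup G) (hsc : SimplyConnectedSpace G) :
    letI : MeasurableSpace G := borel G
    haveI : BorelSpace G := ⟨rfl⟩
    ∀ (r : LatticeRep G) (a : ℝ → ℝ), (∀ β, 0 < a β) → Tendsto a atTop (𝓝 0) → LowerBounds G r a →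
      ∃ (n : ℕ) (ε : ℝ) (θ : ℝ) (ℓ₀ D : ℕ), (0 < θ → ∀ η : ℝ, 1 / 16 ≤ η → ¬ DeepFilmWireAt r.ρ D n η) ∧
        1 ≤ n ∧ 0 ≤ ε ∧ ε * OnsetFormats.shellCount n ≤ 3 / 4 ∧
        ∀ δ : ℝ, 0 < δ → ∃ T β₂ : ℝ, ∀ β : ℝ, β₂ ≤ β → ∃ b : ℕ, 1 ≤ b ∧ a β * (b : ℝ) < T ∧
          ∀ w : Fin 4 → ℤ → ℤ, IsFrame b w →
            ClauseIAll r.ρ β w n ε (TypChainDeep r.ρ θ w ℓ₀ D) ∧ ClauseIIukp r.ρ β w δ (TypChainDeep r.ρ θ w ℓ₀ D) ∧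
              ClauseIII r.ρ β w b δ (TypChainDeep r.ρ θ w ℓ₀ D) := by
  letI : MeasurableSpace G := borel G
  haveI : BorelSpace G := ⟨rfl⟩
  intro r a ha hat hlb
  obtain ⟨n, ε, θ, ℓ₀, D, hn, hε, hM, hsup⟩ := h G hG hsc r a ha hat hlb
  refine ⟨n, ε, θ, ℓ₀, D, fun hθ η hη hW => ?_, hn, hε, hM, hsup⟩
  obtain ⟨β₀, hβ₀⟩ := exists_frame_not_clauseIAll_of_wireAt r.ρ hW
  obtain ⟨T, β₂, hβ₂⟩ := hsup 1 one_pos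
  obtain ⟨b, hb1, -, hframes⟩ := hβ₂ (max β₀ β₂) (le_max_right _ _)
  obtain ⟨w, hw, -, hnot⟩ := hβ₀ (max β₀ β₂) (le_max_left _ _) b hb1 θ hθ ε ((SharpOnset.eps_le_sixteenth hε hM).trans hη) ℓ₀ D le_rfl
  exact hnot (hframes w hw).1

/-- **Every witness of the REDUCED deep supplier statement `TypChainDeepReducedAtSC` avoids the film wire (PROVED):** the printed
`(n, ε, θ, κ, C, D)` (`θ > 0` is part of the statement) satisfy `¬ DeepFilmWireAt r.ρ D n η` for every `η ≥ 1/16`. -/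
theorem typChainDeepReducedAtSC_avoids_filmWire (h : TypChainDeepReducedAtSC) (G : Type) [Group G] [TopologicalSpace G]
    [IsTopologicalGroup G] [CompactSpace G] (hG : IsCompactSimpleLieGroup G) (hsc : SimplyConnectedSpace G) :
    letI : MeasurableSpace G := borel G
    haveI : BorelSpace G := ⟨rfl⟩
    ∀ (r : LatticeRep G) (a : ℝ → ℝ), (∀ β, 0 < a β) → Tendsto a atTop (𝓝 0) → LowerBounds G r a →
      ∃ (n : ℕ) (ε θ κ C : ℝ) (D : ℕ), (∀ η : ℝ, 1 / 16 ≤ η → ¬ DeepFilmWireAt r.ρ D n η) ∧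
        1 ≤ n ∧ 0 ≤ ε ∧ ε * OnsetFormats.shellCount n ≤ 3 / 4 ∧ 0 < θ ∧ 0 < κ ∧
        ∀ δ : ℝ, 0 < δ → ∃ T B β₂ : ℝ, ∀ β : ℝ, β₂ ≤ β →
          ∃ b : ℕ, 1 ≤ b ∧ a β * (b : ℝ) < T ∧ (b : ℝ) ≤ B * Real.exp (C * β) ∧
            ∀ w : Fin 4 → ℤ → ℤ, IsFrame b w →
              ClauseIAll r.ρ β w n ε (TypChainDeep r.ρ θ w (extentOf θ κ C) D) ∧
                KernelPlaqSparseDeep r.ρ β w θ (extentOf θ κ C) D (Real.exp (-(κ * β))) := by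
  letI : MeasurableSpace G := borel G
  haveI : BorelSpace G := ⟨rfl⟩
  intro r a ha hat hlb
  obtain ⟨n, ε, θ, κ, C, D, hn, hε, hM, hθ, hκ, hsup⟩ := h G hG hsc r a ha hat hlb
  refine ⟨n, ε, θ, κ, C, D, fun η hη hW => ?_, hn, hε, hM, hθ, hκ, hsup⟩
  obtain ⟨β₀, hβ₀⟩ := exists_frame_not_clauseIAll_of_wireAt r.ρ hW
  obtain ⟨T, B, β₂, hβ₂⟩ := hsup 1 one_pos
  obtain ⟨b, hb1, -, -, hframes⟩ := hβ₂ (max β₀ β₂) (le_max_right _ _)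
  obtain ⟨w, hw, -, hnot⟩ :=
    hβ₀ (max β₀ β₂) (le_max_left _ _) b hb1 θ hθ ε ((SharpOnset.eps_le_sixteenth hε hM).trans hη) (extentOf θ κ C) D le_rfl
  exact hnot (hframes w hw).1

end Supplier

end Summit.QuantumFields.YangMills.Cruxes.IR.AfPincerUc.SharpLanes.DeepFilm

end
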